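import Summits.AtomisticToContinuum.BoseEinsteinCondensation.Theorems.BECTangentRigidityRigidMomentumBoundSmearStepDeriv
import Mathlib.Analysis.SpecialFunctions.Complex.Analytic
import HarnessLib

/-!
# Crux `RigidMomentumBound` (stmt-AtomisticToContinuum-13034), line `registered`:
# the smearing step, part 5 — integrated bounds for `θ = √(η² + F) - η`

Supports (does not close) stmt-AtomisticToContinuum-13034. Tonelli + translation invariance turn the
pointwise bounds of part 4 into: `∫(DθY)² ≤ ∫|DΦ Y|²`, `∫(Dθ𝟙ₐ)² ≤ π²/(4τ²)`, `∫ V θ² ≤ ∫ V|Φ|²`,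
`∫ relK(θ) ≤ ∫ relK(Φ)`, `‖θ‖₂² ≤ 1 ≤ ‖θ‖₂² + 2η ∫√F`, `∫ √F < ∞`; plus the bookkeeping for the
complexified `θ : (ℝ³)^N → ℂ` and for constant multiples. Folklore (Lieb–Loss Thm 7.8).
-/

noncomputable section

open MeasureTheory Filter Set
open scoped ENNReal NNReal Topology

namespace Summit.AtomisticToContinuum.BoseEinsteinCondensation.Theorems.RigidMomentumBound

open Literature.MathematicalPhysics.QuantumManyBody.BoseGas

namespace SmearStep

variable {N : ℕ} {L₀ : ℝ}

/-! ### Generic bookkeeping -/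

/-- The interaction of a measurable potential is measurable in the configuration. [folklore] -/
theorem measurable_interaction' {v : ℝ → ℝ≥0∞} (hv : Measurable v) :
    Measurable fun X : Config N => interaction v X := by
  refine Finset.measurable_sum _ fun i _ => Finset.measurable_sum _ fun j _ => ?_
  exact hv.comp (by fun_prop)

/-- Derivative of a complexified real function: `D(x ↦ (θ x : ℂ)) Y = (Dθ Y : ℂ)`. [folklore] -/
theorem fderiv_ofReal_comp {θ : Config N → ℝ} (hθ : Differentiable ℝ θ) (X Y : Config N) :
    fderiv ℝ (fun Z => ((θ Z : ℝ) : ℂ)) X Y = ((fderiv ℝ θ X Y : ℝ) : ℂ) := by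
  have h := (Complex.ofRealCLM.hasFDerivAt.comp X (hθ X).hasFDerivAt).fderiv
  rw [show (fun Z => ((θ Z : ℝ) : ℂ)) = (Complex.ofRealCLM ∘ θ) from rfl, h]
  rfl

/-- `‖D(θ : ℂ) Y‖₊² = ofReal ((Dθ Y)²)` for a differentiable real `θ`. [folklore] -/
theorem sq_nnnorm_fderiv_ofReal_comp {θ : Config N → ℝ} (hθ : Differentiable ℝ θ) (X Y : Config N) :
    ((‖fderiv ℝ (fun Z => ((θ Z : ℝ) : ℂ)) X Y‖₊ : ℝ≥0∞)) ^ 2 = ENNReal.ofReal ((fderiv ℝ θ X Y) ^ 2) := by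
  rw [fderiv_ofReal_comp hθ, Complex.nnnorm_real, ofReal_sq_eq_enorm_sq, enorm_eq_nnnorm]

/-- `‖(r : ℂ)‖₊² = ofReal (r²)` (registered sub-goal anchoring this helper file on the crux item).
[folklore] -/
theorem sq_nnnorm_ofReal : ∀ r : ℝ, ((‖((r : ℝ) : ℂ)‖₊ : ENNReal)) ^ 2 = ENNReal.ofReal (r ^ 2) := by
  intro r
  rw [Complex.nnnorm_real, ofReal_sq_eq_enorm_sq, enorm_eq_nnnorm]

/-- **Monotonicity of the relative kinetic energy under directional-derivative domination**: if
`∫|Df Y|² ≤ ∫|Dg Y|²` for every direction `Y`, then `∫ relK(f) ≤ ∫ relK(g)`. [folklore] -/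
theorem lintegral_relKineticDensity_mono {f g : Config N → ℂ}
    (h : ∀ Y : Config N, ∫⁻ X, ((‖fderiv ℝ f X Y‖₊ : ℝ≥0∞)) ^ 2 ≤ ∫⁻ X, ((‖fderiv ℝ g X Y‖₊ : ℝ≥0∞)) ^ 2) :
    ∫⁻ X, relKineticDensity f X ≤ ∫⁻ X, relKineticDensity g X := by
  have hm : ∀ (φ : Config N → ℂ) (Y : Config N),
      Measurable fun X => ((‖fderiv ℝ φ X Y‖₊ : ℝ≥0∞)) ^ 2 := fun φ Y =>
    ((measurable_fderiv_apply_const ℝ φ Y).nnnorm.coe_nnreal_ennreal).pow_const 2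
  have hm3 : ∀ φ : Config N → ℂ, Measurable fun X => ∑ a : Fin 3, ∑ j : Fin N, ∑ k : Fin N,
      ((‖fderiv ℝ φ X (Pi.single j (EuclideanSpace.single a (1 : ℝ)) -
        Pi.single k (EuclideanSpace.single a (1 : ℝ)))‖₊ : ℝ≥0∞)) ^ 2 := fun φ =>
    Finset.measurable_sum _ fun a _ => Finset.measurable_sum _ fun j _ =>
      Finset.measurable_sum _ fun k _ => hm φ _
  unfold relKineticDensity
  rw [lintegral_const_mul _ (hm3 f), lintegral_const_mul _ (hm3 g)]
  gcongr (2 * (N : ℝ≥0∞))⁻¹ * ?_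
  rw [lintegral_finsetSum _ fun a _ => Finset.measurable_sum _ fun j _ =>
      Finset.measurable_sum _ fun k _ => hm f _,
    lintegral_finsetSum _ fun a _ => Finset.measurable_sum _ fun j _ =>
      Finset.measurable_sum _ fun k _ => hm g _]
  refine Finset.sum_le_sum fun a _ => ?_
  rw [lintegral_finsetSum _ fun j _ => Finset.measurable_sum _ fun k _ => hm f _,
    lintegral_finsetSum _ fun j _ => Finset.measurable_sum _ fun k _ => hm g _]
  refine Finset.sum_le_sum fun j _ => ?_
  rw [lintegral_finsetSum _ fun k _ => hm f _, lintegral_finsetSum _ fun k _ => hm g _]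
  exact Finset.sum_le_sum fun k _ => h _

/-- Relative kinetic density of a constant multiple: `relK(c f) = |c|² relK(f)`. [folklore] -/
theorem relKineticDensity_const_mul (c : ℂ) {f : Config N → ℂ} (hf : Differentiable ℝ f) (X : Config N) :
    relKineticDensity (fun Z => c * f Z) X = ((‖c‖₊ : ℝ≥0∞)) ^ 2 * relKineticDensity f X := by
  unfold relKineticDensity
  have hd : fderiv ℝ (fun Z => c * f Z) X = c • fderiv ℝ f X :=
    ((hf X).hasFDerivAt.const_mul c).fderiv
  simp only [hd, FunLike.coe_smul, Pi.smul_apply, smul_eq_mul, nnnorm_mul,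
    ENNReal.coe_mul, mul_pow, ← Finset.mul_sum]
  ring

/-- Rigid derivative of a constant multiple: `|D(cf) Y|² = |c|² |Df Y|²`. [folklore] -/
theorem sq_nnnorm_fderiv_const_mul (c : ℂ) {f : Config N → ℂ} (hf : Differentiable ℝ f)
    (X Y : Config N) :
    ((‖fderiv ℝ (fun Z => c * f Z) X Y‖₊ : ℝ≥0∞)) ^ 2 =
      ((‖c‖₊ : ℝ≥0∞)) ^ 2 * ((‖fderiv ℝ f X Y‖₊ : ℝ≥0∞)) ^ 2 := by
  have hd : fderiv ℝ (fun Z => c * f Z) X = c • fderiv ℝ f X :=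
    ((hf X).hasFDerivAt.const_mul c).fderiv
  rw [hd, FunLike.coe_smul, Pi.smul_apply, smul_eq_mul, nnnorm_mul, ENNReal.coe_mul,
    mul_pow]

/-! ### Integrated bounds -/

section integrated

variable (Φ : TrialState N L₀) (a : Fin 3) {τ : ℝ} (hτ : 0 < τ)
  {w u w' : ℝ → ℝ} (hw0 : ∀ t, 0 ≤ w t) (hu0 : ∀ t, 0 ≤ u t)
  (hwc : Continuous w) (huc : Continuous u)
  (habs : ∀ t, |w' t| = Real.sqrt (w t) * Real.sqrt (u t))
  (hw1 : ∫ t in (0 : ℝ)..(2 * τ), w t = 1)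
  (hu1 : ∫ t in (0 : ℝ)..(2 * τ), u t = Real.pi ^ 2 / τ ^ 2)
  {F : Config N → ℝ}
  (hF : F = fun X => ∫ t in (0 : ℝ)..(2 * τ),
    ‖Φ.ψ (X - t • (fun _ : Fin N => EuclideanSpace.single a (1 : ℝ)))‖ ^ 2 * w t)
  (hFdiff : ContDiff ℝ 1 F)
  (hFderiv : ∀ X Y : Config N, fderiv ℝ F X Y = ∫ t in (0 : ℝ)..(2 * τ),
    fderiv ℝ (fun Z : Config N => ‖Φ.ψ Z‖ ^ 2)
      (X - t • (fun _ : Fin N => EuclideanSpace.single a (1 : ℝ))) Y * w t)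
  (hFrigid : ∀ X : Config N, fderiv ℝ F X (fun _ : Fin N => EuclideanSpace.single a (1 : ℝ)) =
    ∫ t in (0 : ℝ)..(2 * τ),
      ‖Φ.ψ (X - t • (fun _ : Fin N => EuclideanSpace.single a (1 : ℝ)))‖ ^ 2 * w' t)

include hτ hw0 hwc hw1 in
/-- `∫_{(0,2τ]} w = 1` in `ℝ≥0∞`. [folklore] -/
theorem lintegral_ofReal_w : ∫⁻ t in Ioc (0 : ℝ) (2 * τ), ENNReal.ofReal (w t) = 1 := by
  rw [← ofReal_integral_eq_lintegral_ofReal (hwc.integrableOn_Icc.mono_set Ioc_subset_Icc_self)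
    (Eventually.of_forall fun t => hw0 t), ← intervalIntegral.integral_of_le (by linarith), hw1,
    ENNReal.ofReal_one]

include hτ hu0 huc hu1 in
/-- `∫_{(0,2τ]} u = π²/τ²` in `ℝ≥0∞`. [folklore] -/
theorem lintegral_ofReal_u :
    ∫⁻ t in Ioc (0 : ℝ) (2 * τ), ENNReal.ofReal (u t) = ENNReal.ofReal (Real.pi ^ 2 / τ ^ 2) := by
  rw [← ofReal_integral_eq_lintegral_ofReal (huc.integrableOn_Icc.mono_set Ioc_subset_Icc_self)
    (Eventually.of_forall fun t => hu0 t), ← intervalIntegral.integral_of_le (by linarith), hu1]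

include hτ hw0 hwc hw1 hF hFdiff hFderiv in
/-- **`∫ (Dθ Y)² ≤ ∫ |DΦ Y|²`** for every direction `Y`. [folklore] -/
theorem lintegral_sq_fderiv_theta_le {η : ℝ} (hη : 0 < η) (Y : Config N) :
    ∫⁻ X, ENNReal.ofReal ((fderiv ℝ (fun Z => Real.sqrt (η ^ 2 + F Z) - η) X Y) ^ 2) ≤
      ∫⁻ X, ((‖fderiv ℝ Φ.ψ X Y‖₊ : ℝ≥0∞)) ^ 2 := by
  have hk : Measurable fun Z : Config N => ((‖fderiv ℝ Φ.ψ Z Y‖₊ : ℝ≥0∞)) ^ 2 :=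
    ((measurable_fderiv_apply_const ℝ Φ.ψ Y).nnnorm.coe_nnreal_ennreal).pow_const 2
  calc ∫⁻ X, ENNReal.ofReal ((fderiv ℝ (fun Z => Real.sqrt (η ^ 2 + F Z) - η) X Y) ^ 2)
      ≤ ∫⁻ X, ∫⁻ t in Ioc (0 : ℝ) (2 * τ),
          ((‖fderiv ℝ Φ.ψ (X - t • (fun _ : Fin N => EuclideanSpace.single a (1 : ℝ))) Y‖₊ : ℝ≥0∞)
            ^ 2) * ENNReal.ofReal (w t) :=
        lintegral_mono fun X => sq_fderiv_theta_le Φ a hτ hw0 hwc hF hFdiff hFderiv hη X Y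
    _ = (∫⁻ t in Ioc (0 : ℝ) (2 * τ), ENNReal.ofReal (w t)) *
          ∫⁻ X, ((‖fderiv ℝ Φ.ψ X Y‖₊ : ℝ≥0∞)) ^ 2 :=
        lintegral_lintegral_shift hk (ENNReal.measurable_ofReal.comp hwc.measurable) _ _
    _ = ∫⁻ X, ((‖fderiv ℝ Φ.ψ X Y‖₊ : ℝ≥0∞)) ^ 2 := by
        rw [lintegral_ofReal_w hτ hw0 hwc hw1, one_mul]

include hτ hw0 hu0 hwc huc habs hu1 hF hFdiff hFrigid in
/-- **`∫ (Dθ 𝟙ₐ)² ≤ π²/(4τ²)`** (the smeared rigid derivative is controlled by the Fisher information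
of the weight). [folklore] -/
theorem lintegral_sq_fderiv_theta_rigid_le {η : ℝ} (hη : 0 < η) :
    ∫⁻ X, ENNReal.ofReal ((fderiv ℝ (fun Z => Real.sqrt (η ^ 2 + F Z) - η) X
        (fun _ : Fin N => EuclideanSpace.single a (1 : ℝ))) ^ 2) ≤
      ENNReal.ofReal (Real.pi ^ 2 / (4 * τ ^ 2)) := by
  have hk : Measurable fun Z : Config N => ((‖Φ.ψ Z‖₊ : ℝ≥0∞)) ^ 2 :=
    (Φ.contDiff.continuous.measurable.nnnorm.coe_nnreal_ennreal).pow_const 2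
  have hm : Measurable fun X : Config N => ∫⁻ t in Ioc (0 : ℝ) (2 * τ),
      ((‖Φ.ψ (X - t • (fun _ : Fin N => EuclideanSpace.single a (1 : ℝ)))‖₊ : ℝ≥0∞) ^ 2) *
        ENNReal.ofReal (u t) :=
    (measurable_shift_mul hk (ENNReal.measurable_ofReal.comp huc.measurable) _).lintegral_prod_right
  calc ∫⁻ X, ENNReal.ofReal ((fderiv ℝ (fun Z => Real.sqrt (η ^ 2 + F Z) - η) X
          (fun _ : Fin N => EuclideanSpace.single a (1 : ℝ))) ^ 2)
      ≤ ∫⁻ X, 4⁻¹ * ∫⁻ t in Ioc (0 : ℝ) (2 * τ),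
          ((‖Φ.ψ (X - t • (fun _ : Fin N => EuclideanSpace.single a (1 : ℝ)))‖₊ : ℝ≥0∞) ^ 2) *
            ENNReal.ofReal (u t) :=
        lintegral_mono fun X =>
          sq_fderiv_theta_rigid_le Φ a hτ hw0 hu0 hwc huc habs hF hFdiff hFrigid hη X
    _ = 4⁻¹ * ∫⁻ X, ∫⁻ t in Ioc (0 : ℝ) (2 * τ),
          ((‖Φ.ψ (X - t • (fun _ : Fin N => EuclideanSpace.single a (1 : ℝ)))‖₊ : ℝ≥0∞) ^ 2) *
            ENNReal.ofReal (u t) := lintegral_const_mul _ hm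
    _ = 4⁻¹ * ((∫⁻ t in Ioc (0 : ℝ) (2 * τ), ENNReal.ofReal (u t)) *
          ∫⁻ X, ((‖Φ.ψ X‖₊ : ℝ≥0∞)) ^ 2) := by
        congr 1
        exact lintegral_lintegral_shift hk (ENNReal.measurable_ofReal.comp huc.measurable) _ _
    _ = ENNReal.ofReal (Real.pi ^ 2 / (4 * τ ^ 2)) := by
        rw [lintegral_ofReal_u hτ hu0 huc hu1, Φ.norm_eq, mul_one, ← ENNReal.ofReal_ofNat,
          ← ENNReal.ofReal_inv_of_pos (by norm_num), ← ENNReal.ofReal_mul (by norm_num)]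
        congr 1
        field_simp

include hτ hw0 hwc hw1 hF in
/-- **`∫ V θ² ≤ ∫ V |Φ|²`** (the interaction commutes with rigid shifts; `θ² ≤ F`). [folklore] -/
theorem lintegral_interaction_theta_le {v : ℝ → ℝ≥0∞} (hv : Measurable v) {η : ℝ} (hη : 0 ≤ η) :
    ∫⁻ X, interaction v X * ENNReal.ofReal ((Real.sqrt (η ^ 2 + F X) - η) ^ 2) ≤
      ∫⁻ X, interaction v X * ((‖Φ.ψ X‖₊ : ℝ≥0∞)) ^ 2 := by
  have hk : Measurable fun Z : Config N => interaction v Z * ((‖Φ.ψ Z‖₊ : ℝ≥0∞)) ^ 2 :=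
    (measurable_interaction' hv).mul
      ((Φ.contDiff.continuous.measurable.nnnorm.coe_nnreal_ennreal).pow_const 2)
  have hmeas_t : ∀ X : Config N, Measurable fun t : ℝ =>
      ((‖Φ.ψ (X - t • (fun _ : Fin N => EuclideanSpace.single a (1 : ℝ)))‖₊ : ℝ≥0∞) ^ 2) *
        ENNReal.ofReal (w t) := fun X =>
    (((Φ.contDiff.continuous.comp (continuous_const.sub (continuous_id.smul continuous_const)))
      |>.measurable.nnnorm.coe_nnreal_ennreal).pow_const 2).mul
      (ENNReal.measurable_ofReal.comp hwc.measurable)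
  calc ∫⁻ X, interaction v X * ENNReal.ofReal ((Real.sqrt (η ^ 2 + F X) - η) ^ 2)
      ≤ ∫⁻ X, interaction v X * ENNReal.ofReal (F X) := by
        refine lintegral_mono fun X => ?_
        gcongr interaction v X * ?_
        exact ENNReal.ofReal_le_ofReal (sqrtShift_sq_le (F_nonneg Φ a hτ hw0 hF X) hη)
    _ = ∫⁻ X, ∫⁻ t in Ioc (0 : ℝ) (2 * τ),
          (interaction v (X - t • (fun _ : Fin N => EuclideanSpace.single a (1 : ℝ))) *
            ((‖Φ.ψ (X - t • (fun _ : Fin N => EuclideanSpace.single a (1 : ℝ)))‖₊ : ℝ≥0∞) ^ 2)) *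
              ENNReal.ofReal (w t) := by
        refine lintegral_congr fun X => ?_
        rw [ofReal_F_eq Φ a hτ hw0 hwc hF X, ← lintegral_const_mul _ (hmeas_t X)]
        refine lintegral_congr fun t => ?_
        rw [interaction_sub_smul_rigid, mul_assoc]
    _ = (∫⁻ t in Ioc (0 : ℝ) (2 * τ), ENNReal.ofReal (w t)) *
          ∫⁻ X, interaction v X * ((‖Φ.ψ X‖₊ : ℝ≥0∞)) ^ 2 :=
        lintegral_lintegral_shift hk (ENNReal.measurable_ofReal.comp hwc.measurable) _ _
    _ = _ := by rw [lintegral_ofReal_w hτ hw0 hwc hw1, one_mul]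

include hτ hw0 hwc hw1 hF in
/-- **`‖θ‖₂² ≤ 1`** (`θ² ≤ F`, `∫F = 1`). [folklore] -/
theorem lintegral_theta_sq_le_one {η : ℝ} (hη : 0 ≤ η) :
    ∫⁻ X, ENNReal.ofReal ((Real.sqrt (η ^ 2 + F X) - η) ^ 2) ≤ 1 := by
  calc ∫⁻ X, ENNReal.ofReal ((Real.sqrt (η ^ 2 + F X) - η) ^ 2) ≤ ∫⁻ X, ENNReal.ofReal (F X) :=
        lintegral_mono fun X => ENNReal.ofReal_le_ofReal (sqrtShift_sq_le (F_nonneg Φ a hτ hw0 hF X) hη)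
    _ = 1 := lintegral_ofReal_F Φ a hτ hw0 hwc hF hw1

include hτ hw0 hwc hw1 hF hFdiff in
/-- **`1 ≤ ‖θ‖₂² + 2η ∫ √F`** (`F ≤ θ² + 2η√F`, `∫F = 1`). [folklore] -/
theorem one_le_lintegral_theta_sq_add {η : ℝ} (hη : 0 ≤ η) :
    1 ≤ (∫⁻ X, ENNReal.ofReal ((Real.sqrt (η ^ 2 + F X) - η) ^ 2)) +
      ENNReal.ofReal (2 * η) * ∫⁻ X, ENNReal.ofReal (Real.sqrt (F X)) := by
  have hmeas : Measurable fun X => ENNReal.ofReal ((Real.sqrt (η ^ 2 + F X) - η) ^ 2) :=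
    ENNReal.measurable_ofReal.comp (((Real.continuous_sqrt.measurable.comp
      (measurable_const.add hFdiff.continuous.measurable)).sub measurable_const).pow_const 2)
  have hmeas2 : Measurable fun X => ENNReal.ofReal (Real.sqrt (F X)) :=
    ENNReal.measurable_ofReal.comp (Real.continuous_sqrt.measurable.comp hFdiff.continuous.measurable)
  rw [← lintegral_ofReal_F Φ a hτ hw0 hwc hF hw1, ← lintegral_const_mul _ hmeas2,
    ← lintegral_add_left hmeas]
  refine lintegral_mono fun X => ?_
  have hFX := F_nonneg Φ a hτ hw0 hF X
  calc ENNReal.ofReal (F X)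
      ≤ ENNReal.ofReal ((Real.sqrt (η ^ 2 + F X) - η) ^ 2 + 2 * η * Real.sqrt (F X)) :=
        ENNReal.ofReal_le_ofReal (le_sqrtShift_sq_add hFX hη)
    _ = ENNReal.ofReal ((Real.sqrt (η ^ 2 + F X) - η) ^ 2) +
          ENNReal.ofReal (2 * η) * ENNReal.ofReal (Real.sqrt (F X)) := by
        rw [ENNReal.ofReal_add (sq_nonneg _) (by positivity), ENNReal.ofReal_mul (by positivity)]

include hτ hw0 hwc hw1 hF in
/-- **`∫ √F < ∞`**: `√F ≤ √(sup|Φ|²)` and `F` vanishes off the (bounded) enlarged box. [folklore] -/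
theorem lintegral_sqrt_F_lt_top : ∫⁻ X, ENNReal.ofReal (Real.sqrt (F X)) < ⊤ := by
  obtain ⟨M, hM0, hM⟩ := exists_bound_norm_sq Φ
  set R : ℝ := 2 * |L₀ + 2 * τ| + 1
  have hle : ∀ X : Config N, ENNReal.ofReal (Real.sqrt (F X)) ≤
      (Metric.closedBall (0 : Config N) R).indicator (fun _ => ENNReal.ofReal (Real.sqrt M)) X := by
    intro X
    by_cases hX : X ∈ boxN N (L₀ + 2 * τ)
    · rw [Set.indicator_of_mem (boxN_subset_closedBall N (L₀ + 2 * τ) hX)]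
      exact ENNReal.ofReal_le_ofReal (Real.sqrt_le_sqrt (F_le Φ a hτ hw0 hwc hF hw1 hM X))
    · rw [F_eq_zero_of_notMem Φ a hF hτ.le hX, Real.sqrt_zero, ENNReal.ofReal_zero]
      exact zero_le
  calc ∫⁻ X, ENNReal.ofReal (Real.sqrt (F X))
      ≤ ∫⁻ X, (Metric.closedBall (0 : Config N) R).indicator (fun _ => ENNReal.ofReal (Real.sqrt M)) X :=
        lintegral_mono hle
    _ = ENNReal.ofReal (Real.sqrt M) * volume (Metric.closedBall (0 : Config N) R) :=
        lintegral_indicator_const measurableSet_closedBall _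
    _ < ⊤ := ENNReal.mul_lt_top ENNReal.ofReal_lt_top measure_closedBall_lt_top

end integrated

end SmearStep

end Summit.AtomisticToContinuum.BoseEinsteinCondensation.Theorems.RigidMomentumBound

end
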